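import Literature.NumberTheory.LFunctions.NoRealZeroCertificateReplayTable16
import Literature.NumberTheory.LFunctions.NoRealZeroCertificateReplayTable17A
import Literature.NumberTheory.LFunctions.NoRealZeroCertificateReplayTable17B
import Literature.NumberTheory.LFunctions.NoRealZeroCertificateReplayTable17C
import Literature.NumberTheory.LFunctions.NoRealZeroCertificateReplayTable17D
import HarnessLib

/-!
# Kernel replay of the Lu–Zaman–Zhao certificates: the verified prime table for `p < 2^17`

Topic `Literature/NumberTheory/LFunctions`. Assembly of the kernel-verified prime tables of the second
HEAVY tier: `table17 = table17A ++ (table17B ++ (table17C ++ table17D))` (the 5709 primes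
`2^16 < p < 2^17`, verified entrywise in `NoRealZeroCertificateReplayTable17A–D.lean`), `table17_sorted`,
`table17_valid`, and **`table15_17 = table15_16 ++ table17`** — all 12 251 primes `p < 2^17` — with
**`table15_17_valid : TableValid table15_17`** (junction by the bound `2^16`,
`TableValid.append_of_bound`). Used by the `…ReplayHeavy17N*` files (the 21 673 heavy fundamental
discriminants of `(23, 4·10⁵]` whose Table-1 certificate at `λ = 1.6`, `c = 1/5` needs primes in
`(2^16, 2^17)`; Lu–Zaman–Zhao arXiv:2602.03626 §3) through `checkListK`.

## References

* W. Lu, A. Zaman, K. Zhao, *Dirichlet L-functions of quadratic characters have no exceptional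
  zeros for moduli up to 10¹⁰*, Math. Comp. (2026), arXiv:2602.03626, §2.2–§3. [LuZamanZhao2026]
-/

namespace Literature.NumberTheory.LFunctions
namespace LuZamanZhao2026
namespace Replay

/-- **The verified prime table for `2^16 < p < 2^17`** (5709 primes). [folklore] -/
def table17 : List PRow :=
  table17A ++ (table17B ++ (table17C ++ table17D))

set_option maxHeartbeats 0 in
/-- The primes of `table17` increase strictly. [cite: LuZamanZhao2026, §2.2 and (2.3)] -/
theorem table17_sorted : sortedCheck table17 = true := by
  decide +kernel

/-- **`table17` is a valid table.** [cite: LuZamanZhao2026, §2.2 and (2.3)] -/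
theorem table17_valid : TableValid table17 :=
  tableValid_of (entryValid_append table17A_entryValid (entryValid_append table17B_entryValid
    (entryValid_append table17C_entryValid table17D_entryValid))) table17_sorted

/-- **The verified prime table for `p < 2^17`** (12 251 primes): `table15_17 = table15_16 ++ table17`. [folklore] -/
def table15_17 : List PRow :=
  table15_16 ++ table17

set_option maxHeartbeats 0 in
/-- Every prime of `table15_16` is `< 2^16`. [cite: LuZamanZhao2026, §2.2 and (2.3)] -/
theorem table15_16_allPLt : allPLt table15_16 65536 = true := by
  decide +kernel

set_option maxHeartbeats 0 in
/-- Every prime of `table17` is `≥ 2^16`. [cite: LuZamanZhao2026, §2.2 and (2.3)] -/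
theorem table17_allPGe : allPGe table17 65536 = true := by
  decide +kernel

/-- **`table15_17` is a valid table** — the hypothesis of `certifiedAt_of_checkListK` for the second
heavy tier. [cite: LuZamanZhao2026, §2.2 and (2.3)] -/
theorem table15_17_valid : TableValid table15_17 :=
  table15_16_valid.append_of_bound table17_valid 65536 table15_16_allPLt table17_allPGe

end Replay
end LuZamanZhao2026
end Literature.NumberTheory.LFunctions
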